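import Literature.Analysis.FluidPDE.MillerMiddleEigenvalueSupSharp
import HarnessLib

/-!
# The enstrophy production identity of a Navier–Stokes slice and the three Betchov-type sign rules
# (Miller 2019, Thm 4.5 / Cor 4.6 / Lemma 5.1)

Analysis/FluidPDE proofs file (theorems only).  For ONE time slice `v = u(t)`, `W = ∂ₜu(t)` of the unforced
Navier–Stokes system on `ℝ³` (`W + (v·∇)v = νΔv − ∇q`, `div v = 0`, `v` bounded with `Dv, D²v, D³v, W, DW, q, Dq ∈ L²`)
the tree's slice theorems (`SerrinEnstrophyGronwall`, `MillerMiddleEigenvalueGronwall`, `MillerMiddleEigenvalueSup(Sharp)`)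
prove INEQUALITIES for the enstrophy production `∫ Σᵢ ⟪∂ᵢv, ∂ᵢW⟫`; their common Steps 1–4 are isolated here as the
IDENTITY

* `integral_sum_inner_fderiv_eq_of_momentum` — `∫ Σᵢ ⟪∂ᵢv, ∂ᵢW⟫ = −ν ∫‖Δv‖² + ∫ ⟪Δv, (v·∇)v⟫`

(Miller 2019 Thm 4.5 `∂ₜ½‖ω‖² = −‖ω‖²_{Ḣ¹} + ⟨S; ω ⊗ ω⟩`, in the velocity-gradient bookkeeping of the tree:
`∫ Σᵢ⟪∂ᵢv,∂ᵢW⟫ = −∫⟪Δv, W⟫`, the pressure pairing `∫⟪Δv, ∇q⟫ = 0` since `div Δv = 0`), followed by the three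
SIGN RULES for the trilinear term `∫ ⟪Δv, (v·∇)v⟫ = −∫ Σⱼ ⟪∂ⱼv, Dv ∂ⱼv⟫ = ∫ ω·Sω = −4∫ det S` (Betchov 1956 /
Miller Cor 4.6; in the tree through the pointwise algebra for a trace-free `G = Dv`,
`Σⱼ⟪G eⱼ, G(G eⱼ)⟫ = ½ det(G + Gᵀ) − det G = 3 det G − ω·Gω`, and the null Lagrangian `∫ det Dv = 0`) under a
POINTWISE structural hypothesis on the slice:

* `integral_inner_laplacian_convect_nonpos_of_midStrain_nonpos` — if the middle principal strain
  `λ₂(Dv(x)) ≤ 0` at every `x`, then `∫ ⟪Δv, (v·∇)v⟫ ≤ 0` (Miller's Lemma 5.1 with `λ₂⁺ = 0`);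
* `integral_inner_laplacian_convect_eq_zero_of_det_add_adjoint_eq_zero` — if Betchov's invariant
  `det (Dv(x) + Dv(x)ᵀ) = 0` at every `x` («plane strain»), then `∫ ⟪Δv, (v·∇)v⟫ = 0`;
* `integral_inner_laplacian_convect_eq_zero_of_stretching_eq_zero` — if the enstrophy production density
  `ω·Sω = ⟪curl v(x), Dv(x) (curl v(x))⟫ = 0` at every `x`, then `∫ ⟪Δv, (v·∇)v⟫ = 0`.

These are the slice inputs of the PROFILE enstrophy argument of the cell nsreg-p1 ROUND-15 doors S16/S16′/S16γ
(`Theorems/PlaneStrainDoorProfile*`).  References: Miller, ARMA 235 (2020) = arXiv:1710.05569, Thm 4.5, Cor 4.6,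
Lemma 5.1 [Miller2019]; Lemarié-Rieusset 2016, (7.20) [LemarieRieusset2016].
-/

noncomputable section
open MeasureTheory Set Function Filter Topology InnerProductSpace
open scoped ENNReal NNReal ContDiff RealInnerProductSpace Laplacian Matrix

namespace Literature.Analysis.FluidPDE

set_option maxHeartbeats 400000 in
/-- **The enstrophy production identity of one slice** (Miller 2019 Thm 4.5 / Lemarié-Rieusset (7.20), first
equality, in velocity-gradient form).  Let `v : ℝ³ → ℝ³` be smooth and divergence free, `W : ℝ³ → ℝ³` and
`q : ℝ³ → ℝ` be `C¹`, with the momentum equation `W + (v·∇)v = νΔv − ∇q`, `v` bounded, and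
`Dv, D²v, D³v, W, DW, q, Dq ∈ L²`.  Then `∫ Σᵢ ⟪∂ᵢv, ∂ᵢW⟫ = −ν ∫‖Δv‖² + ∫ ⟪Δv, (v·∇)v⟫`.
[cite: Miller2019, Thm 4.5] [cite: LemarieRieusset2016, (7.20)] -/
theorem integral_sum_inner_fderiv_eq_of_momentum {ν : ℝ}
    {v W : EuclideanSpace ℝ (Fin 3) → EuclideanSpace ℝ (Fin 3)} {q : EuclideanSpace ℝ (Fin 3) → ℝ}
    (hv : ContDiff ℝ ∞ v) (hW : ContDiff ℝ 1 W) (hq : ContDiff ℝ 1 q)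
    (hmom : ∀ x, W x + FluidPDE.convect v v x = ν • (Δ v) x - gradient q x)
    (hdiv : VectorCalculus.IsDivFree v) {B : ℝ} (hB : ∀ x, ‖v x‖ ≤ B)
    (hv1 : ∫⁻ x, ‖iteratedFDeriv ℝ 1 v x‖ₑ ^ 2 < ⊤) (hv2 : ∫⁻ x, ‖iteratedFDeriv ℝ 2 v x‖ₑ ^ 2 < ⊤)
    (hv3 : ∫⁻ x, ‖iteratedFDeriv ℝ 3 v x‖ₑ ^ 2 < ⊤)
    (hW0 : ∫⁻ x, ‖W x‖ₑ ^ 2 < ⊤) (hW1 : ∫⁻ x, ‖iteratedFDeriv ℝ 1 W x‖ₑ ^ 2 < ⊤)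
    (hq0 : ∫⁻ x, ‖q x‖ₑ ^ 2 < ⊤) (hq1 : ∫⁻ x, ‖iteratedFDeriv ℝ 1 q x‖ₑ ^ 2 < ⊤) :
    ∫ x, ∑ i, ⟪fderiv ℝ v x (EuclideanSpace.basisFun (Fin 3) ℝ i),
        fderiv ℝ W x (EuclideanSpace.basisFun (Fin 3) ℝ i)⟫ =
      -ν * (∫ x, ‖(Δ v) x‖ ^ 2) + ∫ x, ⟪(Δ v) x, FluidPDE.convect v v x⟫ := by
  set e := EuclideanSpace.basisFun (Fin 3) ℝ with he
  have he1 : ∀ i, ‖e i‖ = 1 := fun i => by simp [he]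
  have hB0 : 0 ≤ B := (norm_nonneg _).trans (hB 0)
  -- smoothness and continuity
  have hv3' : ContDiff ℝ 3 v := hv.of_le (by norm_cast)
  have hv2' : ContDiff ℝ 2 v := hv.of_le (by norm_cast)
  have hΔ1 : ContDiff ℝ 1 (Δ v) := contDiff_one_laplacian_of_contDiff_three hv3'
  have cv : Continuous v := hv.continuous
  have cDv : Continuous (fderiv ℝ v) := hv.continuous_fderiv (by simp)
  have cD2 : Continuous fun x => iteratedFDeriv ℝ 2 v x := hv.continuous_iteratedFDeriv (by norm_cast)
  have cD3 : Continuous fun x => iteratedFDeriv ℝ 3 v x := hv.continuous_iteratedFDeriv (by norm_cast)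
  have cdiv : ∀ i, Continuous fun x => fderiv ℝ v x (e i) := fun i => cDv.clm_apply continuous_const
  have cdvs : ∀ j i, Continuous fun x => fderiv ℝ (fun y => fderiv ℝ v y (e j)) x (e i) := fun j i =>
    ((((hv3'.fderiv_right (m := 2) (by norm_num)).clm_apply contDiff_const).continuous_fderiv
      (by norm_num)).clm_apply continuous_const)
  have cW : Continuous W := hW.continuous
  have cDW : Continuous (fderiv ℝ W) := hW.continuous_fderiv one_ne_zero
  have cdiW : ∀ i, Continuous fun x => fderiv ℝ W x (e i) := fun i => cDW.clm_apply continuous_const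
  have cq : Continuous q := hq.continuous
  have cDq : Continuous (fderiv ℝ q) := hq.continuous_fderiv one_ne_zero
  have cdiq : ∀ i, Continuous fun x => fderiv ℝ q x (e i) := fun i => cDq.clm_apply continuous_const
  have cgq : Continuous (gradient q) := by
    have : gradient q = fun x => (InnerProductSpace.toDual ℝ _).symm (fderiv ℝ q x) := rfl
    rw [this]
    exact (InnerProductSpace.toDual ℝ (EuclideanSpace ℝ (Fin 3))).symm.continuous.comp cDq
  have cΔ : Continuous (Δ v) := hΔ1.continuous
  have cdΔ : ∀ i, Continuous fun x => fderiv ℝ (Δ v) x (e i) := fun i =>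
    (hΔ1.continuous_fderiv one_ne_zero).clm_apply continuous_const
  have cconv : Continuous (FluidPDE.convect v v) := cDv.clm_apply cv
  have c3D2 : Continuous fun x => (3 : ℝ) • iteratedFDeriv ℝ 2 v x := cD2.const_smul (3 : ℝ)
  have c3D3 : Continuous fun x => (3 : ℝ) • iteratedFDeriv ℝ 3 v x := cD3.const_smul (3 : ℝ)
  have cBDv : Continuous fun x => B • fderiv ℝ v x := cDv.const_smul B
  -- pointwise norm bounds
  have hDv_eq : ∀ x, ‖fderiv ℝ v x‖ = ‖iteratedFDeriv ℝ 1 v x‖ := fun x => by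
    rw [← norm_iteratedFDeriv_fderiv, norm_iteratedFDeriv_zero]
  have n_Δ : ∀ x, ‖(Δ v) x‖ ≤ ‖(3 : ℝ) • iteratedFDeriv ℝ 2 v x‖ := fun x => by
    rw [norm_smul, Real.norm_of_nonneg (by norm_num : (0 : ℝ) ≤ 3)]
    exact norm_laplacian_le_three_mul_norm_iteratedFDeriv_two hv2' x
  have n_dΔ : ∀ i x, ‖fderiv ℝ (Δ v) x (e i)‖ ≤ ‖(3 : ℝ) • iteratedFDeriv ℝ 3 v x‖ := fun i x => by
    rw [norm_smul, Real.norm_of_nonneg (by norm_num : (0 : ℝ) ≤ 3),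
      fderiv_laplacian_apply_of_contDiff_three hv3' x (e i)]
    exact (norm_laplacian_le_three_mul_norm_iteratedFDeriv_two
      ((hv3'.fderiv_right (m := 2) (by norm_num)).clm_apply contDiff_const) x).trans
      (mul_le_mul_of_nonneg_left (norm_iteratedFDeriv_fderiv_apply_basisFun_le hv3' 2 (by norm_num) x i)
        (by norm_num))
  have n_conv : ∀ x, ‖FluidPDE.convect v v x‖ ≤ ‖B • fderiv ℝ v x‖ := fun x => by
    rw [FluidPDE.convect, norm_smul, Real.norm_of_nonneg hB0, mul_comm]
    exact (fderiv ℝ v x).le_opNorm_of_le (hB x)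
  have n_gq : ∀ x, ‖gradient q x‖ = ‖iteratedFDeriv ℝ 1 q x‖ := fun x => by
    rw [gradient, LinearIsometryEquiv.norm_map, ← norm_iteratedFDeriv_fderiv, norm_iteratedFDeriv_zero]
  have hin : ∀ i (y : EuclideanSpace ℝ (Fin 3)), ‖⟪e i, y⟫‖ ≤ ‖y‖ := fun i y =>
    (norm_inner_le_norm (𝕜 := ℝ) (e i) y).trans (by rw [he1, one_mul])
  -- finite `L²` norms
  have l2Dv : ∫⁻ x, ‖fderiv ℝ v x‖ₑ ^ 2 < ⊤ :=
    lintegral_enorm_sq_lt_top_of_norm_le (fun x => (hDv_eq x).le) hv1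
  have l2smul3 : ∀ {n : ℕ}, ∫⁻ x, ‖iteratedFDeriv ℝ n v x‖ₑ ^ 2 < ⊤ →
      ∫⁻ x, ‖(3 : ℝ) • iteratedFDeriv ℝ n v x‖ₑ ^ 2 < ⊤ := by
    intro n h
    have : ∀ x, ‖(3 : ℝ) • iteratedFDeriv ℝ n v x‖ₑ ^ 2 =
        ENNReal.ofReal (3 ^ 2) * ‖iteratedFDeriv ℝ n v x‖ₑ ^ 2 := by
      intro x
      rw [enorm_smul, mul_pow, Real.enorm_eq_ofReal (by norm_num : (0:ℝ) ≤ 3),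
        ENNReal.ofReal_pow (by norm_num : (0:ℝ) ≤ 3)]
    simp_rw [this]
    rw [lintegral_const_mul' _ _ ENNReal.ofReal_ne_top]
    exact ENNReal.mul_lt_top ENNReal.ofReal_lt_top h
  have l2Δ : ∫⁻ x, ‖(3 : ℝ) • iteratedFDeriv ℝ 2 v x‖ₑ ^ 2 < ⊤ := l2smul3 hv2
  have l2dΔ : ∫⁻ x, ‖(3 : ℝ) • iteratedFDeriv ℝ 3 v x‖ₑ ^ 2 < ⊤ := l2smul3 hv3
  have l2BDv : ∫⁻ x, ‖B • fderiv ℝ v x‖ₑ ^ 2 < ⊤ := by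
    have : ∀ x, ‖B • fderiv ℝ v x‖ₑ ^ 2 = ‖B‖ₑ ^ 2 * ‖fderiv ℝ v x‖ₑ ^ 2 := fun x => by
      rw [enorm_smul, mul_pow]
    simp_rw [this]
    rw [lintegral_const_mul' _ _ (by simp)]
    exact ENNReal.mul_lt_top (by simp) l2Dv
  have l2gq : ∫⁻ x, ‖gradient q x‖ₑ ^ 2 < ⊤ :=
    lintegral_enorm_sq_lt_top_of_norm_le (fun x => (n_gq x).le) hq1
  have l2diq : ∀ i, ∫⁻ x, ‖fderiv ℝ q x (e i)‖ₑ ^ 2 < ⊤ := fun i =>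
    lintegral_enorm_sq_lt_top_of_norm_le (fun x => norm_fderiv_apply_basisFun_le q x i) hq1
  have l2div : ∀ i, ∫⁻ x, ‖fderiv ℝ v x (e i)‖ₑ ^ 2 < ⊤ := fun i =>
    lintegral_enorm_sq_lt_top_of_norm_le (fun x => by
      simpa [he1] using (fderiv ℝ v x).le_opNorm (e i)) l2Dv
  have l2diW : ∀ i, ∫⁻ x, ‖fderiv ℝ W x (e i)‖ₑ ^ 2 < ⊤ := fun i =>
    lintegral_enorm_sq_lt_top_of_norm_le (fun x => norm_fderiv_apply_basisFun_le W x i) hW1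
  have l2ddv : ∀ i, ∫⁻ x, ‖fderiv ℝ (fun y => fderiv ℝ v y (e i)) x (e i)‖ₑ ^ 2 < ⊤ := fun i =>
    lintegral_enorm_sq_lt_top_of_norm_le (fun x => norm_fderiv_fderiv_apply_basisFun_le hv2' x i) hv2
  -- integrability of the products
  have i1 : ∀ i, Integrable (fun x => ⟪fderiv ℝ (fun y => fderiv ℝ v y (e i)) x (e i), W x⟫)
      volume := fun i =>
    integrable_of_norm_le_mul_of_lintegral_sq ((cdvs i i).inner cW).aestronglyMeasurable (cdvs i i) cW
      (l2ddv i) hW0 fun x => norm_inner_le_norm _ _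
  have i2 : ∀ i, Integrable (fun x => ⟪fderiv ℝ v x (e i), fderiv ℝ W x (e i)⟫) volume := fun i =>
    integrable_of_norm_le_mul_of_lintegral_sq ((cdiv i).inner (cdiW i)).aestronglyMeasurable
      (cdiv i) (cdiW i) (l2div i) (l2diW i) fun x => norm_inner_le_norm _ _
  have i3 : ∀ i, Integrable (fun x => ⟪fderiv ℝ v x (e i), W x⟫) volume := fun i =>
    integrable_of_norm_le_mul_of_lintegral_sq ((cdiv i).inner cW).aestronglyMeasurable (cdiv i) cW
      (l2div i) hW0 fun x => norm_inner_le_norm _ _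
  have iΔΔ : Integrable (fun x => ‖(Δ v) x‖ ^ 2) volume :=
    FluidPDE.integrable_sq_norm_of_lintegral_lt_top cΔ (lintegral_enorm_sq_lt_top_of_norm_le n_Δ l2Δ)
  have iΔg : Integrable (fun x => ⟪(Δ v) x, gradient q x⟫) volume :=
    integrable_of_norm_le_mul_of_lintegral_sq (cΔ.inner cgq).aestronglyMeasurable c3D2 cgq
      l2Δ l2gq fun x => (norm_inner_le_norm _ _).trans
        (mul_le_mul_of_nonneg_right (n_Δ x) (norm_nonneg _))
  have iΔc : Integrable (fun x => ⟪(Δ v) x, FluidPDE.convect v v x⟫) volume :=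
    integrable_of_norm_le_mul_of_lintegral_sq (cΔ.inner cconv).aestronglyMeasurable c3D2 cBDv
      l2Δ l2BDv fun x => (norm_inner_le_norm _ _).trans
        (mul_le_mul (n_Δ x) (n_conv x) (norm_nonneg _) (norm_nonneg _))
  -- Step 1: `∫ Σᵢ ⟪∂ᵢv, ∂ᵢW⟫ = -∫ ⟪Δv, W⟫`
  have hL := integral_sum_inner_fderiv_fderiv_eq_neg_integral_inner_laplacian hv2' hW i1 i2 i3
  -- Step 2: the pressure term vanishes
  have hpress : ∫ x, ⟪(Δ v) x, gradient q x⟫ = 0 := by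
    have hswap : (fun x => ⟪(Δ v) x, gradient q x⟫) = fun x => ⟪gradient q x, (Δ v) x⟫ :=
      funext fun x => real_inner_comm _ _
    rw [hswap]
    refine integral_inner_gradient_eq_zero_of_isDivFree_R3 hq hΔ1
      (isDivFree_laplacian_of_contDiff_three hv3' hdiv) (fun i => ?_) (fun i => ?_) (fun i => ?_)
    · refine integrable_of_norm_le_mul_of_lintegral_sq
        ((continuous_const.inner cΔ).mul (cdiq i)).aestronglyMeasurable c3D2 (cdiq i) l2Δ (l2diq i)
        fun x => ?_
      rw [norm_mul]
      exact mul_le_mul ((hin i _).trans (n_Δ x)) le_rfl (norm_nonneg _) (norm_nonneg _)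
    · refine integrable_of_norm_le_mul_of_lintegral_sq
        ((continuous_const.inner (cdΔ i)).mul cq).aestronglyMeasurable c3D3 cq l2dΔ hq0
        fun x => ?_
      rw [norm_mul]
      exact mul_le_mul ((hin i _).trans (n_dΔ i x)) le_rfl (norm_nonneg _) (norm_nonneg _)
    · refine integrable_of_norm_le_mul_of_lintegral_sq
        ((continuous_const.inner cΔ).mul cq).aestronglyMeasurable c3D2 cq l2Δ hq0
        fun x => ?_
      rw [norm_mul]
      exact mul_le_mul ((hin i _).trans (n_Δ x)) le_rfl (norm_nonneg _) (norm_nonneg _)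
  -- Step 3: the pointwise identity `-⟪Δv, W⟫ = -ν‖Δv‖² + ⟪Δv, (v·∇)v⟫ + ⟪Δv, ∇q⟫`
  have hpt : ∀ x, -⟪(Δ v) x, W x⟫ =
      -ν * ‖(Δ v) x‖ ^ 2 + ⟪(Δ v) x, FluidPDE.convect v v x⟫ + ⟪(Δ v) x, gradient q x⟫ := by
    intro x
    have hWx : W x = ν • (Δ v) x - FluidPDE.convect v v x - gradient q x := by
      have h : W x = ν • (Δ v) x - gradient q x - FluidPDE.convect v v x :=
        eq_sub_iff_add_eq.2 (hmom x)
      rw [h]; abel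
    rw [hWx, inner_sub_right, inner_sub_right, inner_smul_right, real_inner_self_eq_norm_sq]
    ring
  -- Step 4: integrate
  have iA : Integrable (fun x => -ν * ‖(Δ v) x‖ ^ 2) volume := iΔΔ.const_mul _
  have iAB : Integrable (fun x => -ν * ‖(Δ v) x‖ ^ 2 + ⟪(Δ v) x, FluidPDE.convect v v x⟫) volume :=
    iA.add iΔc
  have hint : ∫ x, -⟪(Δ v) x, W x⟫ =
      -ν * (∫ x, ‖(Δ v) x‖ ^ 2) + (∫ x, ⟪(Δ v) x, FluidPDE.convect v v x⟫) +
        ∫ x, ⟪(Δ v) x, gradient q x⟫ := by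
    rw [integral_congr_ae (Eventually.of_forall hpt), integral_add iAB iΔg, integral_add iA iΔc,
      integral_const_mul]
  have hneg_int : ∫ x, -⟪(Δ v) x, W x⟫ = - ∫ x, ⟪(Δ v) x, W x⟫ := integral_neg _
  rw [hL, ← hneg_int, hint, hpress, add_zero]

/-! ### The trilinear term under a pointwise structural hypothesis (Betchov's sign rules) -/

section SignRules

variable {v : EuclideanSpace ℝ (Fin 3) → EuclideanSpace ℝ (Fin 3)}

/-- `tr G³ = 3 det G` for a trace-free `3 × 3` array (Newton). [folklore] -/
private theorem sum_cube_eq_three_mul_det'' (G : Fin 3 → Fin 3 → ℝ) (htr : ∑ i, G i i = 0) :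
    ∑ i, ∑ j, ∑ k, G i j * G j k * G k i = 3 * Matrix.det (Matrix.of fun i j => G i j) := by
  rw [Matrix.det_fin_three]
  simp only [Fin.sum_univ_three, Matrix.of_apply] at htr ⊢
  have h00 : G 0 0 = -(G 1 1 + G 2 2) := by linarith
  rw [h00]
  ring

/-- Betchov's first identity for a trace-free `3 × 3` array `G`:
`Σ_{ijk} Gᵢⱼ Gᵢₖ Gₖⱼ = ½ det (G + Gᵀ) − det G`. [cite: Miller2019, Cor 4.6] -/
private theorem stretch_eq_half_det_add_transpose_sub_det'' (G : Fin 3 → Fin 3 → ℝ)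
    (htr : ∑ i, G i i = 0) :
    ∑ i, ∑ j, ∑ k, G i j * G i k * G k j =
      2⁻¹ * Matrix.det (Matrix.of fun i j => G i j + G j i) - Matrix.det (Matrix.of fun i j => G i j) := by
  rw [Matrix.det_fin_three, Matrix.det_fin_three]
  simp only [Fin.sum_univ_three, Matrix.of_apply] at htr ⊢
  have h00 : G 0 0 = -(G 1 1 + G 2 2) := by linarith
  rw [h00]
  ring

/-- Betchov's second identity for a trace-free `3 × 3` array `G` with vorticity vector
`ω = (G₂₁ − G₁₂, G₀₂ − G₂₀, G₁₀ − G₀₁)`: `Σ_{ijk} Gᵢⱼ Gᵢₖ Gₖⱼ = 3 det G − Σᵢⱼ ωᵢ Gᵢⱼ ωⱼ`. [cite: Miller2019, Cor 4.6] -/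
private theorem stretch_eq_three_det_sub_vort'' (G : Fin 3 → Fin 3 → ℝ) (htr : ∑ i, G i i = 0) :
    ∑ i, ∑ j, ∑ k, G i j * G i k * G k j =
      3 * Matrix.det (Matrix.of fun i j => G i j) -
        ∑ i, ∑ j, (![G 2 1 - G 1 2, G 0 2 - G 2 0, G 1 0 - G 0 1] i) * G i j *
          (![G 2 1 - G 1 2, G 0 2 - G 2 0, G 1 0 - G 0 1] j) := by
  rw [Matrix.det_fin_three]
  simp only [Fin.sum_univ_three, Matrix.of_apply, Matrix.cons_val_zero, Matrix.cons_val_one,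
    Matrix.cons_val_two, Matrix.head_cons, Matrix.tail_cons] at htr ⊢
  have h00 : G 0 0 = -(G 1 1 + G 2 2) := by linarith
  rw [h00]
  ring

/-- `Σⱼ ⟪L eⱼ, L (L eⱼ)⟫ = Σ_{ijk} Gᵢⱼ Gᵢₖ Gₖⱼ` in the standard matrix `G` of `L`. [folklore] -/
private theorem sum_inner_apply_apply_eq_sum''
    (L : EuclideanSpace ℝ (Fin 3) →L[ℝ] EuclideanSpace ℝ (Fin 3)) :
    ∑ j, ⟪L (EuclideanSpace.basisFun (Fin 3) ℝ j), L (L (EuclideanSpace.basisFun (Fin 3) ℝ j))⟫_ℝ =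
      ∑ i, ∑ j, ∑ k,
        stdMatrix (L : EuclideanSpace ℝ (Fin 3) →ₗ[ℝ] EuclideanSpace ℝ (Fin 3)) i j *
        stdMatrix (L : EuclideanSpace ℝ (Fin 3) →ₗ[ℝ] EuclideanSpace ℝ (Fin 3)) i k *
        stdMatrix (L : EuclideanSpace ℝ (Fin 3) →ₗ[ℝ] EuclideanSpace ℝ (Fin 3)) k j := by
  set e := EuclideanSpace.basisFun (Fin 3) ℝ with he
  have hG : ∀ i j, stdMatrix (L : EuclideanSpace ℝ (Fin 3) →ₗ[ℝ] EuclideanSpace ℝ (Fin 3)) i j =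
      (L (e j)) i := fun i j => by
    rw [stdMatrix_apply, ContinuousLinearMap.coe_coe, he, EuclideanSpace.basisFun_apply]
  have hexp : ∀ w : EuclideanSpace ℝ (Fin 3), L w = ∑ k, w k • L (e k) := by
    intro w
    conv_lhs => rw [← (EuclideanSpace.basisFun (Fin 3) ℝ).sum_repr' w]
    simp [map_sum, map_smul, he, EuclideanSpace.inner_single_left]
  have hinner : ∀ x y : EuclideanSpace ℝ (Fin 3), ⟪x, y⟫_ℝ = ∑ i, x i * y i := by
    intro x y
    rw [EuclideanSpace.inner_eq_star_dotProduct, dotProduct]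
    simp [mul_comm]
  simp_rw [hG]
  calc ∑ j, ⟪L (e j), L (L (e j))⟫_ℝ
      = ∑ j, ∑ k, (L (e j)) k * ⟪L (e j), L (e k)⟫_ℝ := by
        refine Finset.sum_congr rfl fun j _ => ?_
        conv_lhs => rw [hexp (L (e j))]
        rw [inner_sum]
        exact Finset.sum_congr rfl fun k _ => by rw [real_inner_smul_right]
    _ = ∑ j, ∑ k, (L (e j)) k * ∑ i, (L (e j)) i * (L (e k)) i := by
        simp_rw [hinner]
    _ = ∑ j, ∑ i, ∑ k, (L (e j)) i * (L (e k)) i * (L (e j)) k := by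
        refine Finset.sum_congr rfl fun j _ => ?_
        rw [Finset.sum_comm]
        refine Finset.sum_congr rfl fun i _ => ?_
        rw [Finset.mul_sum]
        refine Finset.sum_congr rfl fun k _ => by ring
    _ = ∑ i, ∑ j, ∑ k, (L (e j)) i * (L (e k)) i * (L (e j)) k := Finset.sum_comm

/-- The standard matrix of `L + L†` is `G + Gᵀ`: its determinant is `det (Gᵢⱼ + Gⱼᵢ)`. [folklore] -/
private theorem det_add_adjoint_eq_det_of''
    (L : EuclideanSpace ℝ (Fin 3) →L[ℝ] EuclideanSpace ℝ (Fin 3)) :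
    (L + ContinuousLinearMap.adjoint L).det =
      Matrix.det (Matrix.of fun i j =>
        stdMatrix (L : EuclideanSpace ℝ (Fin 3) →ₗ[ℝ] EuclideanSpace ℝ (Fin 3)) i j +
        stdMatrix (L : EuclideanSpace ℝ (Fin 3) →ₗ[ℝ] EuclideanSpace ℝ (Fin 3)) j i) := by
  set M : EuclideanSpace ℝ (Fin 3) →ₗ[ℝ] EuclideanSpace ℝ (Fin 3) :=
    ((L + ContinuousLinearMap.adjoint L : EuclideanSpace ℝ (Fin 3) →L[ℝ] EuclideanSpace ℝ (Fin 3)) :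
      EuclideanSpace ℝ (Fin 3) →ₗ[ℝ] EuclideanSpace ℝ (Fin 3)) with hM
  have hdet : (L + ContinuousLinearMap.adjoint L).det = Matrix.det (stdMatrix M) := by
    rw [hM]
    exact (LinearMap.det_toMatrix _ _).symm
  rw [hdet]
  congr 1
  ext i j
  rw [Matrix.of_apply, stdMatrix_apply, stdMatrix_apply, stdMatrix_apply, hM]
  simp only [ContinuousLinearMap.coe_coe]
  change (L (EuclideanSpace.single j (1 : ℝ)) +
    ContinuousLinearMap.adjoint L (EuclideanSpace.single j (1 : ℝ))) i = _
  rw [PiLp.add_apply]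
  congr 1
  have h1 : (ContinuousLinearMap.adjoint L (EuclideanSpace.single j (1 : ℝ))) i =
      ⟪ContinuousLinearMap.adjoint L (EuclideanSpace.single j (1 : ℝ)), EuclideanSpace.single i (1 : ℝ)⟫_ℝ := by
    rw [EuclideanSpace.inner_single_right]; simp
  rw [h1, ContinuousLinearMap.adjoint_inner_left, EuclideanSpace.inner_single_left]
  simp

/-- Integrability of the cubic velocity-gradient terms `⟪∂ⱼv, Dv ∂ⱼv⟫` for bounded `Dv ∈ L²`. [folklore] -/
private theorem integrable_inner_fderiv_apply_apply'' (hv : ContDiff ℝ 1 v)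
    {B₁ : ℝ} (hB₁ : ∀ x, ‖fderiv ℝ v x‖ ≤ B₁) (hv1 : ∫⁻ x, ‖iteratedFDeriv ℝ 1 v x‖ₑ ^ 2 < ⊤) (j : Fin 3) :
    Integrable (fun x => ⟪fderiv ℝ v x (EuclideanSpace.basisFun (Fin 3) ℝ j),
      fderiv ℝ v x (fderiv ℝ v x (EuclideanSpace.basisFun (Fin 3) ℝ j))⟫_ℝ) volume := by
  set e := EuclideanSpace.basisFun (Fin 3) ℝ with he
  have he1 : ∀ i, ‖e i‖ = 1 := fun i => by simp [he]
  have cDv : Continuous (fderiv ℝ v) := hv.continuous_fderiv (by simp)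
  have cdiv : Continuous fun x => fderiv ℝ v x (e j) := cDv.clm_apply continuous_const
  have hDv_eq : ∀ x, ‖fderiv ℝ v x‖ = ‖iteratedFDeriv ℝ 1 v x‖ := fun x => by
    rw [← norm_iteratedFDeriv_fderiv, norm_iteratedFDeriv_zero]
  have l2Dv : ∫⁻ x, ‖fderiv ℝ v x‖ₑ ^ 2 < ⊤ :=
    lintegral_enorm_sq_lt_top_of_norm_le (fun x => (hDv_eq x).le) hv1
  have l2div : ∫⁻ x, ‖fderiv ℝ v x (e j)‖ₑ ^ 2 < ⊤ :=
    lintegral_enorm_sq_lt_top_of_norm_le (fun x => by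
      simpa [he1] using (fderiv ℝ v x).le_opNorm (e j)) l2Dv
  have i_a : Integrable (fun x => ‖fderiv ℝ v x (e j)‖ ^ 2) volume :=
    FluidPDE.integrable_sq_norm_of_lintegral_lt_top cdiv l2div
  have hdom : Integrable (fun x => B₁ * ‖fderiv ℝ v x (e j)‖ ^ 2) volume := i_a.const_mul _
  refine hdom.mono' (cdiv.inner (cDv.clm_apply cdiv)).aestronglyMeasurable
    (Eventually.of_forall fun x => ?_)
  calc ‖⟪fderiv ℝ v x (e j), fderiv ℝ v x (fderiv ℝ v x (e j))⟫_ℝ‖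
      ≤ ‖fderiv ℝ v x (e j)‖ * ‖fderiv ℝ v x (fderiv ℝ v x (e j))‖ := norm_inner_le_norm _ _
    _ ≤ ‖fderiv ℝ v x (e j)‖ * (B₁ * ‖fderiv ℝ v x (e j)‖) :=
        mul_le_mul_of_nonneg_left ((fderiv ℝ v x).le_of_opNorm_le (hB₁ x) _) (norm_nonneg _)
    _ = B₁ * ‖fderiv ℝ v x (e j)‖ ^ 2 := by ring

/-- `‖∇vᵢ(y)‖ ≤ ‖Dv(y)‖`. [folklore] -/
private theorem norm_gradient_coord_le_norm_fderiv₃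
    {y : EuclideanSpace ℝ (Fin 3)} (hd : DifferentiableAt ℝ v y) (i : Fin 3) :
    ‖gradient (fun z => v z i) y‖ ≤ ‖fderiv ℝ v y‖ := by
  set w := gradient (fun z => v z i) y with hw
  have h1 : ‖w‖ ^ 2 ≤ ‖fderiv ℝ v y‖ * ‖w‖ := by
    rw [← real_inner_self_eq_norm_sq, hw, inner_gradient_coord_eq hd i]
    calc fderiv ℝ v y (gradient (fun z => v z i) y) i
        ≤ |fderiv ℝ v y (gradient (fun z => v z i) y) i| := le_abs_self _
      _ ≤ ‖fderiv ℝ v y (gradient (fun z => v z i) y)‖ := by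
          simpa [Real.norm_eq_abs] using
            PiLp.norm_apply_le (fderiv ℝ v y (gradient (fun z => v z i) y)) i
      _ ≤ ‖fderiv ℝ v y‖ * ‖gradient (fun z => v z i) y‖ := (fderiv ℝ v y).le_opNorm _
  by_cases hw0 : ‖w‖ = 0
  · rw [hw0]; exact norm_nonneg _
  · exact le_of_mul_le_mul_right (by nlinarith [h1]) (lt_of_le_of_ne (norm_nonneg _) (Ne.symm hw0))

/-- `det ∇v` is integrable for a `C¹` field with bounded gradient `Dv ∈ L²`. [folklore] -/
private theorem integrable_det_fderiv₃ (hv : ContDiff ℝ 1 v)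
    {B₁ : ℝ} (hB₁ : ∀ x, ‖fderiv ℝ v x‖ ≤ B₁)
    (hv1 : ∫⁻ x, ‖iteratedFDeriv ℝ 1 v x‖ₑ ^ 2 < ⊤) :
    Integrable (fun x => LinearMap.det
      (fderiv ℝ v x : EuclideanSpace ℝ (Fin 3) →ₗ[ℝ] EuclideanSpace ℝ (Fin 3))) volume := by
  have hdV : ∀ y, DifferentiableAt ℝ v y := fun y => (hv.differentiable (by simp)) y
  have hDv_eq : ∀ x, ‖fderiv ℝ v x‖ = ‖iteratedFDeriv ℝ 1 v x‖ := fun x => by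
    rw [← norm_iteratedFDeriv_fderiv, norm_iteratedFDeriv_zero]
  have l2Dv : ∫⁻ x, ‖fderiv ℝ v x‖ₑ ^ 2 < ⊤ :=
    lintegral_enorm_sq_lt_top_of_norm_le (fun x => (hDv_eq x).le) hv1
  have lfrob : ∫⁻ x, ENNReal.ofReal (FluidPDE.frobeniusNormSq (fderiv ℝ v x)) < ⊤ :=
    calc ∫⁻ x, ENNReal.ofReal (FluidPDE.frobeniusNormSq (fderiv ℝ v x))
        ≤ ∫⁻ x, 3 * ‖fderiv ℝ v x‖ₑ ^ 2 :=
          lintegral_mono fun x => ofReal_frobeniusNormSq_le_three_mul_enorm_sq _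
      _ = 3 * ∫⁻ x, ‖fderiv ℝ v x‖ₑ ^ 2 := lintegral_const_mul' _ _ (by norm_num)
      _ < ⊤ := ENNReal.mul_lt_top (by norm_num) l2Dv
  have ifrob : Integrable (fun x => FluidPDE.frobeniusNormSq (fderiv ℝ v x)) volume :=
    integrable_of_continuous_of_nonneg (FluidPDE.continuous_frobeniusNormSq_fderiv hv (by simp))
      (fun x => FluidPDE.frobeniusNormSq_nonneg _) lfrob
  have hgc : Continuous fun x => LinearMap.det
      (fderiv ℝ v x : EuclideanSpace ℝ (Fin 3) →ₗ[ℝ] EuclideanSpace ℝ (Fin 3)) := by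
    have : (fun x => LinearMap.det
        (fderiv ℝ v x : EuclideanSpace ℝ (Fin 3) →ₗ[ℝ] EuclideanSpace ℝ (Fin 3))) =
        fun x => (fderiv ℝ v x).det := rfl
    rw [this]
    exact ContinuousLinearMap.continuous_det.comp (hv.continuous_fderiv (by simp))
  refine (ifrob.const_mul (1 / 2 * B₁)).mono' hgc.aestronglyMeasurable (Eventually.of_forall fun y => ?_)
  rw [Real.norm_eq_abs, det_fderiv_eq_inner_gradient_cross (hdV y)]
  set g0 := gradient (fun z => v z 0) y
  set g1 := gradient (fun z => v z 1) y
  set g2 := gradient (fun z => v z 2) y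
  have hcross : ‖cross g1 g2‖ ≤ ‖g1‖ * ‖g2‖ := by
    rw [norm_cross]
    exact mul_le_of_le_one_right (by positivity) (Real.sin_le_one _)
  have hF := frobeniusNormSq_fderiv_eq_sum_norm_gradient_sq (hdV y)
  have hgg : ‖g1‖ * ‖g2‖ ≤ (1 / 2) * FluidPDE.frobeniusNormSq (fderiv ℝ v y) := by
    rw [hF]
    nlinarith [sq_nonneg (‖g1‖ - ‖g2‖), sq_nonneg ‖g0‖]
  calc |⟪g0, cross g1 g2⟫_ℝ| ≤ ‖g0‖ * ‖cross g1 g2‖ := abs_real_inner_le_norm _ _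
    _ ≤ ‖fderiv ℝ v y‖ * (‖g1‖ * ‖g2‖) :=
        mul_le_mul (norm_gradient_coord_le_norm_fderiv₃ (hdV y) 0) hcross (norm_nonneg _) (norm_nonneg _)
    _ ≤ B₁ * ((1 / 2) * FluidPDE.frobeniusNormSq (fderiv ℝ v y)) :=
        mul_le_mul (hB₁ y) hgg (by positivity) ((norm_nonneg _).trans (hB₁ y))
    _ = 1 / 2 * B₁ * FluidPDE.frobeniusNormSq (fderiv ℝ v y) := by ring

/-- **Sign rule I (Miller's Lemma 5.1 at `λ₂⁺ = 0`)**: if the middle principal strain of `Dv(x)` is `≤ 0` at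
every `x`, then `∫ ⟪Δv, (v·∇)v⟫ ≤ 0` — pointwise `−Σⱼ⟪∂ⱼv, Dv ∂ⱼv⟫ ≤ 2λ₂⁺|Dv|² + det Dv = det Dv`, and
`∫ det Dv = 0`.  (`v` smooth, divergence free, bounded with bounded gradient, `Dv, D²v ∈ L²`.)
[cite: Miller2019, Lemma 5.1] -/
theorem integral_inner_laplacian_convect_nonpos_of_midStrain_nonpos (hv : ContDiff ℝ ∞ v)
    (hdiv : VectorCalculus.IsDivFree v) {B : ℝ} (hB : ∀ x, ‖v x‖ ≤ B)
    {B₁ : ℝ} (hB₁ : ∀ x, ‖fderiv ℝ v x‖ ≤ B₁)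
    (hv1 : ∫⁻ x, ‖iteratedFDeriv ℝ 1 v x‖ₑ ^ 2 < ⊤) (hv2 : ∫⁻ x, ‖iteratedFDeriv ℝ 2 v x‖ₑ ^ 2 < ⊤)
    (hmid : ∀ x, strainEigenvalues
      (fderiv ℝ v x : EuclideanSpace ℝ (Fin 3) →ₗ[ℝ] EuclideanSpace ℝ (Fin 3))
        finrank_euclideanSpace_fin 1 ≤ 0) :
    ∫ x, ⟪(Δ v) x, FluidPDE.convect v v x⟫ ≤ 0 := by
  have hv3' : ContDiff ℝ 3 v := hv.of_le (by norm_cast)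
  have hv1' : ContDiff ℝ 1 v := hv.of_le (by norm_cast)
  have i_Tj := integrable_inner_fderiv_apply_apply'' hv1' hB₁ hv1
  have idet := integrable_det_fderiv₃ hv1' hB₁ hv1
  rw [integral_inner_laplacian_convect_eq_neg_sum hv3' hdiv hB hB₁ hv1 hv2,
    ← integral_finsetSum _ fun j _ => i_Tj j, ← integral_neg,
    ← integral_det_fderiv_eq_zero hv hB hB₁ hv1]
  refine integral_mono (integrable_finsetSum _ fun j _ => i_Tj j).neg idet fun x => ?_
  have h := neg_sum_inner_apply_apply_le_midStrain (fderiv ℝ v x) (hdiv x)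
  have h0 : max (strainEigenvalues
      (fderiv ℝ v x : EuclideanSpace ℝ (Fin 3) →ₗ[ℝ] EuclideanSpace ℝ (Fin 3))
        finrank_euclideanSpace_fin 1) 0 = 0 := max_eq_right (hmid x)
  rw [h0, mul_zero, zero_mul, zero_add] at h
  simpa only using h

/-- **Sign rule II (Betchov, «plane strain»)**: if `det (Dv(x) + Dv(x)ᵀ) = 0` at every `x`, then
`∫ ⟪Δv, (v·∇)v⟫ = 0` — pointwise `Σⱼ⟪∂ⱼv, Dv ∂ⱼv⟫ = ½ det (Dv + Dvᵀ) − det Dv = −det Dv`, and `∫ det Dv = 0`.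
[cite: Miller2019, Cor 4.6] -/
theorem integral_inner_laplacian_convect_eq_zero_of_det_add_adjoint_eq_zero (hv : ContDiff ℝ ∞ v)
    (hdiv : VectorCalculus.IsDivFree v) {B : ℝ} (hB : ∀ x, ‖v x‖ ≤ B)
    {B₁ : ℝ} (hB₁ : ∀ x, ‖fderiv ℝ v x‖ ≤ B₁)
    (hv1 : ∫⁻ x, ‖iteratedFDeriv ℝ 1 v x‖ₑ ^ 2 < ⊤) (hv2 : ∫⁻ x, ‖iteratedFDeriv ℝ 2 v x‖ₑ ^ 2 < ⊤)
    (hdet : ∀ x, (fderiv ℝ v x + ContinuousLinearMap.adjoint (fderiv ℝ v x)).det = 0) :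
    ∫ x, ⟪(Δ v) x, FluidPDE.convect v v x⟫ = 0 := by
  have hv3' : ContDiff ℝ 3 v := hv.of_le (by norm_cast)
  have hv1' : ContDiff ℝ 1 v := hv.of_le (by norm_cast)
  have i_Tj := integrable_inner_fderiv_apply_apply'' hv1' hB₁ hv1
  rw [integral_inner_laplacian_convect_eq_neg_sum hv3' hdiv hB hB₁ hv1 hv2,
    ← integral_finsetSum _ fun j _ => i_Tj j]
  have hpt : ∀ x, ∑ j, ⟪fderiv ℝ v x (EuclideanSpace.basisFun (Fin 3) ℝ j),
      fderiv ℝ v x (fderiv ℝ v x (EuclideanSpace.basisFun (Fin 3) ℝ j))⟫_ℝ =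
      -LinearMap.det (fderiv ℝ v x : EuclideanSpace ℝ (Fin 3) →ₗ[ℝ] EuclideanSpace ℝ (Fin 3)) := by
    intro x
    set L := fderiv ℝ v x with hL
    set Ll : EuclideanSpace ℝ (Fin 3) →ₗ[ℝ] EuclideanSpace ℝ (Fin 3) := ↑L with hLl
    set G : Matrix (Fin 3) (Fin 3) ℝ := stdMatrix Ll with hGdef
    have htrG : ∑ i, G i i = 0 := by
      have h := trace_stdMatrix Ll
      have htr : LinearMap.trace ℝ _ Ll = 0 := hdiv x
      rw [htr] at h
      simpa [Matrix.trace, Matrix.diag, hGdef] using h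
    rw [sum_inner_apply_apply_eq_sum'' L, stretch_eq_half_det_add_transpose_sub_det'' G htrG,
      ← det_add_adjoint_eq_det_of'' L, hdet x]
    have hofG : (Matrix.of fun i j => G i j) = G := by ext i j; rfl
    rw [hofG, hGdef, LinearMap.det_toMatrix]
    ring
  simp_rw [hpt]
  rw [integral_neg, integral_det_fderiv_eq_zero hv hB hB₁ hv1, neg_zero, neg_zero]

/-- **Sign rule III (Betchov, «production-free»)**: if the enstrophy production density
`ω·Sω = ⟪curl v(x), Dv(x) (curl v(x))⟫` vanishes at every `x`, then `∫ ⟪Δv, (v·∇)v⟫ = 0` — pointwise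
`Σⱼ⟪∂ⱼv, Dv ∂ⱼv⟫ = 3 det Dv − ω·Dv ω = 3 det Dv`, and `∫ det Dv = 0`. [cite: Miller2019, Cor 4.6] -/
theorem integral_inner_laplacian_convect_eq_zero_of_stretching_eq_zero (hv : ContDiff ℝ ∞ v)
    (hdiv : VectorCalculus.IsDivFree v) {B : ℝ} (hB : ∀ x, ‖v x‖ ≤ B)
    {B₁ : ℝ} (hB₁ : ∀ x, ‖fderiv ℝ v x‖ ≤ B₁)
    (hv1 : ∫⁻ x, ‖iteratedFDeriv ℝ 1 v x‖ₑ ^ 2 < ⊤) (hv2 : ∫⁻ x, ‖iteratedFDeriv ℝ 2 v x‖ₑ ^ 2 < ⊤)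
    (hprod : ∀ x, ⟪curl v x, fderiv ℝ v x (curl v x)⟫_ℝ = 0) :
    ∫ x, ⟪(Δ v) x, FluidPDE.convect v v x⟫ = 0 := by
  have hv3' : ContDiff ℝ 3 v := hv.of_le (by norm_cast)
  have hv1' : ContDiff ℝ 1 v := hv.of_le (by norm_cast)
  have i_Tj := integrable_inner_fderiv_apply_apply'' hv1' hB₁ hv1
  rw [integral_inner_laplacian_convect_eq_neg_sum hv3' hdiv hB hB₁ hv1 hv2,
    ← integral_finsetSum _ fun j _ => i_Tj j]
  have hpt : ∀ x, ∑ j, ⟪fderiv ℝ v x (EuclideanSpace.basisFun (Fin 3) ℝ j),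
      fderiv ℝ v x (fderiv ℝ v x (EuclideanSpace.basisFun (Fin 3) ℝ j))⟫_ℝ =
      3 * LinearMap.det (fderiv ℝ v x : EuclideanSpace ℝ (Fin 3) →ₗ[ℝ] EuclideanSpace ℝ (Fin 3)) := by
    intro x
    set e := EuclideanSpace.basisFun (Fin 3) ℝ with he
    set L := fderiv ℝ v x with hL
    set Ll : EuclideanSpace ℝ (Fin 3) →ₗ[ℝ] EuclideanSpace ℝ (Fin 3) := ↑L with hLl
    set G : Matrix (Fin 3) (Fin 3) ℝ := stdMatrix Ll with hGdef
    have htrG : ∑ i, G i i = 0 := by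
      have h := trace_stdMatrix Ll
      have htr : LinearMap.trace ℝ _ Ll = 0 := hdiv x
      rw [htr] at h
      simpa [Matrix.trace, Matrix.diag, hGdef] using h
    have hG : ∀ i j, G i j = (L (e j)) i := fun i j => by
      rw [hGdef, stdMatrix_apply, hLl, ContinuousLinearMap.coe_coe, he, EuclideanSpace.basisFun_apply]
    -- the vorticity vector in coordinates and the quadratic form `ω·Gω`
    set w : Fin 3 → ℝ := ![G 2 1 - G 1 2, G 0 2 - G 2 0, G 1 0 - G 0 1] with hw
    have hcurl : curl v x = WithLp.toLp 2 w := by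
      rw [hw, hGdef, hLl, hL, curl_eq_stdMatrix v x]
    have hwi : ∀ i, (curl v x) i = w i := fun i => by rw [hcurl, PiLp.toLp_apply]
    have hexp : ∀ z : EuclideanSpace ℝ (Fin 3), L z = ∑ k, z k • L (e k) := by
      intro z
      conv_lhs => rw [← (EuclideanSpace.basisFun (Fin 3) ℝ).sum_repr' z]
      simp [map_sum, map_smul, he, EuclideanSpace.inner_single_left]
    have hLi : ∀ (z : EuclideanSpace ℝ (Fin 3)) (i : Fin 3), (L z) i = ∑ k, G i k * z k := by
      intro z i
      rw [hexp z]
      simp only [WithLp.ofLp_sum, WithLp.ofLp_smul, Finset.sum_apply, Pi.smul_apply, smul_eq_mul, hG]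
      exact Finset.sum_congr rfl fun k _ => mul_comm _ _
    have hinner : ∀ a b : EuclideanSpace ℝ (Fin 3), ⟪a, b⟫_ℝ = ∑ i, a i * b i := by
      intro a b
      rw [EuclideanSpace.inner_eq_star_dotProduct, dotProduct]
      simp [mul_comm]
    have hq : ⟪curl v x, L (curl v x)⟫_ℝ = ∑ i, ∑ j, w i * G i j * w j := by
      rw [hinner]
      refine Finset.sum_congr rfl fun i _ => ?_
      rw [hLi, hwi, Finset.mul_sum]
      refine Finset.sum_congr rfl fun j _ => ?_
      rw [hwi]; ring
    have hzero : ∑ i, ∑ j, w i * G i j * w j = 0 := by rw [← hq]; exact hprod x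
    rw [sum_inner_apply_apply_eq_sum'' L, stretch_eq_three_det_sub_vort'' G htrG]
    have hofG : (Matrix.of fun i j => G i j) = G := by ext i j; rfl
    rw [hofG, ← hw, hzero, sub_zero, hGdef, LinearMap.det_toMatrix]
  simp_rw [hpt]
  rw [integral_const_mul, integral_det_fderiv_eq_zero hv hB hB₁ hv1, mul_zero, neg_zero]

end SignRules

end Literature.Analysis.FluidPDE

end
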